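import Summits.PneNP.PneNP.Theorems.OneSliceSingleThresholdTwoRoundTransfer

/-!
# The two-round transfer at sharp size: `NoisyIndist(size ≤ s+1) → (err ≤ δ ⇒ size > s)`

Route `OneSlice`, crux `Summit.PneNP.PneNP.Theses.OneSlice.SingleThreshold` (stmt-PneNP-2833), line
`two-round-exposure` (lead c3): the registered stub `stub_twoRoundTransferSharp` (stub A′), the
exponent-exact form of the landed lever `stub_twoRoundTransfer` (stub A, this file's import).

**What.** Fix `k ≥ 5`, `ε > 0` and ANY size function `s : ℕ → ℕ`. If for every `γ > 0`,
eventually in `n`, every monotone `{∧₂,∨₂,0,1}`-circuit `D` with `|D| ≤ s n + 1` has noisy-planted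
advantage `adv_q(D) ≤ γ` at the sprinkle density `q = pMinus k ε n` (`A` a uniform `k`-set), then
there is `δ > 0` such that eventually every monotone `{∧₂,∨₂}`-circuit `C` which is `δ`-accurate for
`k`-CLIQUE at the critical density has `|C| > s n`. Stub A is the case `s n = n^c` with the
hypothesis weakened to `|D| ≤ n^{c+1}`; the point of the sharp form is the bookkeeping of the crux's
first open exponent: `SingleThreshold` at `c = 2` follows from NoisyIndist for circuits of size
`≤ n² + 1` (linear in the number `C(n,2)` of inputs), while below `n²/k²` gates NoisyIndist holds by
locality (`stub_advLeReads`).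

**How.** Verbatim the proof of `stub_twoRoundTransfer` (Rossman 2010, §7 and App. B: advantage at
`p` is `≥ κ₀/2` for a `κ₀κ₁/8`-accurate monotone `C` by `adv_lower_bound` and Lemma 23, and is the
`w_{p₁}`-average of the `q`-advantages of the restrictions `C^{H'}`, each a monotone01 circuit with at
most ONE more gate, `adv_union_le`), the size hypothesis being consumed exactly at `|C| + 1 ≤ s n + 1`.

## References

* B. Rossman, *The monotone complexity of k-clique on random graphs*, FOCS 2010, 193–201; SIAM J.
  Comput. 43 (2014) 256–279 — §7 (p. 10) and Appendix B (Lemmas 17 and 23, pp. 13–14) [Rossman2010].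
-/

noncomputable section

set_option linter.dupNamespace false

open Finset Filter

open scoped Classical Topology

namespace Summit.PneNP.PneNP.Theorems.SingleThreshold

open Literature.Computability.Complexity GateList
open Summit.PneNP.PneNP.Theorems.SingleThreshold.Negative (Edges pc err pc_nonneg pc_le_one)

/-- **Stub A′ — the two-round transfer at sharp size** (see the module docstring): NoisyIndist for
monotone01 circuits of size `≤ s n + 1` at the sprinkle density `pMinus k ε n` implies that
`δ`-accurate monotone circuits for `k`-CLIQUE at the critical density have more than `s n` gates,
eventually, for some `δ > 0`. [cite: Rossman2010, §7 and App. B (pp. 10, 13–14)] -/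
theorem stub_twoRoundTransferSharp :
    ∀ (k : ℕ) (ε : ℝ) (s : ℕ → ℕ), 5 ≤ k → 0 < ε →
      (∀ γ : ℝ, 0 < γ →
      ∀ᶠ n : ℕ in atTop, ∀ D : Circuit (⊤ : SimpleGraph (Fin n)).edgeSet,
        D.IsOver monotoneBasis01 → D.size ≤ s n + 1 →
          (∑ x : ((⊤ : SimpleGraph (Fin n)).edgeSet → Bool),
              gnpWeight n (pMinus k ε n) x *
                kSubsetProb n k (fun A => D.eval (x ⊔ cliqueVec A) = true)) -
            gnpProb n (pMinus k ε n) (univ.filter fun x => D.eval x = true) ≤ γ) →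
      ∃ δ : ℝ, 0 < δ ∧ ∀ᶠ n : ℕ in Filter.atTop,
        ∀ C : Literature.Computability.Complexity.Circuit ((⊤ : SimpleGraph (Fin n)).edgeSet),
          C.IsOver Literature.Computability.Complexity.monotoneBasis →
            (Finset.univ.filter (fun x : ((⊤ : SimpleGraph (Fin n)).edgeSet) → Bool =>
                C.eval x ≠ decide (¬ (SimpleGraph.fromEdgeSet {e : Sym2 (Fin n) |
                  ∃ h : e ∈ (⊤ : SimpleGraph (Fin n)).edgeSet, x ⟨e, h⟩ = true}).CliqueFree k))).sum
              (fun x => ((n : ℝ) ^ (-(2 : ℝ) / ((k : ℝ) - 1))) ^ (Finset.univ.filter (fun e => x e = true)).card *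
                (1 - (n : ℝ) ^ (-(2 : ℝ) / ((k : ℝ) - 1))) ^
                  (n.choose 2 - (Finset.univ.filter (fun e => x e = true)).card)) ≤ δ →
            s n < C.size := by
  intro k ε s hk hε hN
  have hk2 : 2 ≤ k := le_trans (by norm_num) hk
  -- the two threshold constants `κ₀ ≤ Pr[ω_k = 0]`, `κ₁ ≤ Pr[ω_k = 1]`
  set κ₀ : ℝ := Real.exp (-(2 * (1 : ℝ) ^ k.choose 2)) with hκ₀
  set κ₁ : ℝ := (1 : ℝ) ^ k.choose 2 / (2 ^ k * k.factorial) *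
    Real.exp (-(2 * (k * 2 ^ k * (1 : ℝ) ^ k.choose 2))) with hκ₁
  have hκ₀pos : 0 < κ₀ := Real.exp_pos _
  have hκ₁pos : 0 < κ₁ := by positivity
  refine ⟨κ₀ * κ₁ / 8, by positivity, ?_⟩
  -- the critical density as a threshold function
  have hp01 : ∀ n : ℕ, 0 ≤ pc n k ∧ pc n k ≤ 1 := fun n => ⟨pc_nonneg n k, pc_le_one' n hk2⟩
  have hab : ∀ᶠ n : ℕ in atTop, 1 * (n : ℝ) ^ (-(2 : ℝ) / ((k : ℝ) - 1)) ≤ pc n k ∧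
      pc n k ≤ 1 * (n : ℝ) ^ (-(2 : ℝ) / ((k : ℝ) - 1)) :=
    Eventually.of_forall fun n => by rw [one_mul]; exact ⟨le_rfl, le_rfl⟩
  have hpb : ∀ᶠ n : ℕ in atTop, 0 ≤ pc n k ∧ pc n k ≤ 1 * (n : ℝ) ^ (-(2 : ℝ) / ((k : ℝ) - 1)) :=
    hab.mono fun n hn => ⟨pc_nonneg n k, hn.2⟩
  have hA : ∀ᶠ n : ℕ in atTop, κ₀ ≤ gnpProb n (pc n k) (univ.filter fun x => cliqueCount n k x = 0) :=
    eventually_le_gnpProb_cliqueFree (p := fun n => pc n k) hk2 le_rfl hpb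
  have hE1 : ∀ᶠ n : ℕ in atTop, κ₁ ≤ gnpProb n (pc n k) (univ.filter fun x => cliqueCount n k x = 1) :=
    eventually_le_gnpProb_cliqueCount_eq_one (p := fun n => pc n k) hk2 one_pos le_rfl hab
  -- Lemma 23
  have hTV : Tendsto (fun n => ∑ H : Edges n → Bool,
      |condOneCliqueLaw n k (pc n k) H - plantedCliqueFreeLaw n k (pc n k) H|) atTop (𝓝 0) :=
    Rossman2010_plantedVsConditioned_holds k hk (fun n => pc n k) hp01 (Asymptotics.isTheta_refl _ _)
  have hTVev : ∀ᶠ n : ℕ in atTop, ∑ H : Edges n → Bool,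
      |condOneCliqueLaw n k (pc n k) H - plantedCliqueFreeLaw n k (pc n k) H| ≤ κ₀ / 8 :=
    hTV.eventually_le_const (by positivity)
  -- the hypothesis at `γ = κ₀ / 4`
  have hNγ := hN (κ₀ / 4) (by positivity)
  show ∀ᶠ n : ℕ in atTop, ∀ C : Circuit (Edges n), C.IsOver monotoneBasis →
    err n k C ≤ κ₀ * κ₁ / 8 → s n < C.size
  filter_upwards [hNγ, hA, hE1, hTVev, eventually_ge_atTop k, eventually_ge_atTop 2] with n hNn hAn
    hE1n hTVn hkn hn2
  intro C hC herr
  by_contra hsz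
  push Not at hsz
  -- the densities `q ≤ p ≤ 1` and `p₁ = (p - q)/(1 - q)`
  have hn1 : 1 ≤ n := by omega
  have hp0 : 0 ≤ pc n k := pc_nonneg n k
  have hp1 : pc n k ≤ 1 := pc_le_one hn1 hk2
  have hqp : pMinus k ε n ≤ pc n k := pMinus_le_pc hn1 hk2 hε.le
  have hq1 : pMinus k ε n < 1 := pMinus_lt_one hn2 hk2 hε.le
  have h1q : 0 < 1 - pMinus k ε n := by linarith
  set p₁ : ℝ := (pc n k - pMinus k ε n) / (1 - pMinus k ε n) with hp₁
  have hp₁0 : 0 ≤ p₁ := div_nonneg (by linarith) h1q.le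
  have hp₁1 : p₁ ≤ 1 := by rw [hp₁, div_le_one h1q]; linarith
  have hpp : p₁ + pMinus k ε n - p₁ * pMinus k ε n = pc n k := by
    rw [hp₁]
    field_simp
    ring
  -- `C` is monotone
  have hC01 : C.IsOver monotoneBasis01 := hC.mono monotoneBasis_subset_monotoneBasis01
  have hmono : Monotone C.eval := C.monotone_eval_of_isOver_monotoneBasis01 hC01
  -- UPPER bound on the advantage at `p`: two-round exposure and the hypothesis (sharp size)
  have hupper : (∑ z : Edges n → Bool, gnpWeight n (pc n k) z *
        kSubsetProb n k (fun A => C.eval (z ⊔ cliqueVec A) = true)) -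
      gnpProb n (pc n k) (univ.filter fun z => C.eval z = true) ≤ κ₀ / 4 := by
    rw [← hpp]
    refine adv_union_le hp₁0 hp₁1 C hC01 fun D hD hDsize => hNn D hD ?_
    calc D.size ≤ C.size + 1 := hDsize
      _ ≤ s n + 1 := by omega
  -- LOWER bound on the advantage at `p`: Lemma 17 / Lemma 23
  have hP₁ : 0 < gnpProb n (pc n k) (univ.filter fun x => cliqueCount n k x = 1) :=
    hκ₁pos.trans_le hE1n
  have hlower := adv_lower_bound hp0 hp1 hkn C.eval hmono hP₁
  have herr' : gnpProb n (pc n k) (univ.filter fun x => C.eval x ≠ cliqueFn n k x) ≤ κ₀ * κ₁ / 8 :=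
    herr
  have herr0 : 0 ≤ gnpProb n (pc n k) (univ.filter fun x => C.eval x ≠ cliqueFn n k x) :=
    gnpProb_nonneg hp0 hp1 _
  have hκ₁1 : κ₁ ≤ 1 := hE1n.trans (gnpProb_le_one hp0 hp1 _)
  have hdiv : gnpProb n (pc n k) (univ.filter fun x => C.eval x ≠ cliqueFn n k x) /
      gnpProb n (pc n k) (univ.filter fun x => cliqueCount n k x = 1) ≤ κ₀ / 8 := by
    rw [div_le_iff₀ hP₁]
    have := mul_le_mul_of_nonneg_left hE1n (by positivity : (0 : ℝ) ≤ κ₀ / 8)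
    linarith
  have h2δ : 2 * (κ₀ * κ₁ / 8) ≤ κ₀ / 4 := by nlinarith
  linarith

end Summit.PneNP.PneNP.Theorems.SingleThreshold

end
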